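import Summits.Langlands.Langlands.Theorems.IrreducibilityBySelfDualityReciprocityUpToIrreducibility
import Literature.NumberTheory.Automorphic.IsAutomorphicAE

/-!
# Sketch — first lemmas for the crux ideas on `ReciprocityUpToIrreducibility`
(crux stmt-Langlands-14328, route IrreducibilityBySelfDuality; crux-ideate round 1, ideator k = 2)

Two idea cards:
* `isobaric-bootstrap` — Jacquet–Shalika isobaric rigidity + (B) for all ranks makes irreducibility
  and the fine structure of (A) automatic; `E ⟸ WeakExistence ∧ WeakAutomorphy ∧ PairCompatibility`
  and, as a by-product, `E → Langlands`.
* `one-prime-companions` — compatible-system rigidity converts `∀ ℓ` into `∃ ℓ`: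
  `WeakExistence ∧ WeakAutomorphy ⟸ Companions ∧ ExistenceAtOnePrime ∧ AutomorphyAtOnePrime`.
Everything is stated over existing declarations; the composition theorems are `sorry`
(they are the crux-plan's job), the multiset lemma is proved.
-/

open scoped NumberField Classical Polynomial
open Filter IsDedekindDomain Polynomial
open Literature.NumberTheory.Automorphic Literature.NumberTheory.GaloisRepresentations
open Summit.Langlands
open Summit.Langlands.Langlands.Theses.IrreducibilityBySelfDuality
open Summit.Langlands.Langlands.Theorems.IrreducibleGL3CM
open Summit.Langlands.Langlands.Theorems.ReciprocityUpToIrreducibility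

noncomputable section
set_option linter.dupNamespace false

namespace Summit.Langlands.Langlands.Cruxes.ReciprocityUpToIrreducibility.Sketch

/-! ## 0. The L-normalised Satake–Frobenius dictionary is multiplicative (provable now) -/

/-- `arithFrobPolyOfSatake ι q 1 (α + β) = (…α) * (…β)`: a direct sum of compatible Galois
representations corresponds to the UNION of Satake multisets. [folklore] -/
theorem arithFrobPolyOfSatake_add {ℓ : ℕ} [Fact ℓ.Prime] (ι : PadicAlgCl ℓ ≃+* ℂ) (q m : ℕ)
    (α β : Multiset ℂ) :
    arithFrobPolyOfSatake ι q m (α + β) =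
      arithFrobPolyOfSatake ι q m α * arithFrobPolyOfSatake ι q m β := by
  simp [arithFrobPolyOfSatake, Multiset.map_add, Multiset.prod_add]

/-- … and over a finite family. [folklore] -/
theorem arithFrobPolyOfSatake_sum {ℓ : ℕ} [Fact ℓ.Prime] (ι : PadicAlgCl ℓ ≃+* ℂ) (q m : ℕ)
    {k : ℕ} (β : Fin k → Multiset ℂ) :
    arithFrobPolyOfSatake ι q m (∑ i, β i) = ∏ i, arithFrobPolyOfSatake ι q m (β i) := by
  classical
  induction k with
  | zero => simp [arithFrobPolyOfSatake]
  | succ k ih =>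
    rw [Fin.sum_univ_castSucc, Fin.prod_univ_castSucc, arithFrobPolyOfSatake_add, ih]

/-! ## 1. The decoupled statements (card `isobaric-bootstrap`) -/

/-- Geometric, in the summit's PINNED sense, written without a `ReciprocityData` argument
(`ReciprocityData.pst` ignores its argument): unramified a.e. and de Rham at every `v ∣ ℓ`
for Fontaine's pinned datum. -/
def IsGeometricPinned {K : Type} [Field K] [NumberField K] {ℓ : ℕ} [Fact ℓ.Prime] {n : ℕ}
    (ρ : FramedGaloisRep K (PadicAlgCl ℓ) n) : Prop :=
  (∀ᶠ v : HeightOneSpectrum (𝓞 K) in cofinite, ρ.IsUnramifiedAt v) ∧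
    ∀ (v : HeightOneSpectrum (𝓞 K)) (hv : ((ℓ : ℕ) : 𝓞 K) ∈ v.asIdeal),
      (Literature.NumberTheory.PAdicHodge.fontainePstAdicCompletion v ℓ hv).IsDeRhamFramed
        (ρ.toLocal v)

/-- Sanity: the pinned predicate IS the summit's `IsGeometricFramed Rec` for every `Rec`. -/
theorem isGeometricFramed_iff {K : Type} [Field K] [NumberField K] (Rec : ReciprocityData K)
    {ℓ : ℕ} [Fact ℓ.Prime] {n : ℕ} (ρ : FramedGaloisRep K (PadicAlgCl ℓ) n) :
    IsGeometricFramed Rec ρ ↔ IsGeometricPinned ρ := Iff.rfl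

/-- **W — weak existence (the datum-free core of direction (A)).**  Every L-algebraic cuspidal
`π` of `GL_n(𝔸_K)` has, for every `ℓ, ι`, SOME geometric `ρ` (no irreducibility, no local–global
compatibility, no uniqueness) attached at almost all places.  This is the printed shape of every
construction theorem (Deligne, HLTT Thm A, Scholze Cor. V.4.2 — plus de Rham-ness). -/
def WeakExistence : Prop :=
  ∀ (K : Type) [Field K] [NumberField K] (n : ℕ) (hcpt : isCompact_glFiniteIntegralLevel n K),
    0 < n → ∀ π : CuspidalAutomorphicRepData n K hcpt, π.1.IsLAlgebraic →
      ∀ (ℓ : ℕ) [Fact ℓ.Prime] (ι : PadicAlgCl ℓ ≃+* ℂ),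
        ∃ ρ : FramedGaloisRep K (PadicAlgCl ℓ) n, IsGeometricPinned ρ ∧
          ∀ᶠ v : HeightOneSpectrum (𝓞 K) in cofinite, SatakeFrobCompatibleAt ι π.1 ρ v

/-- **B_w — weak automorphy (Fontaine–Mazur–Langlands, almost-everywhere form).** -/
def WeakAutomorphy : Prop :=
  ∀ (K : Type) [Field K] [NumberField K] (n : ℕ) (hcpt : isCompact_glFiniteIntegralLevel n K),
    0 < n → ∀ (ℓ : ℕ) [Fact ℓ.Prime] (ι : PadicAlgCl ℓ ≃+* ℂ) (ρ : FramedGaloisRep K (PadicAlgCl ℓ) n),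
      ρ.toGaloisRep.IsIrreducible → IsGeometricPinned ρ →
        ∃ π : CuspidalAutomorphicRepData n K hcpt, π.1.IsLAlgebraic ∧
          ∀ᶠ v : HeightOneSpectrum (𝓞 K) in cofinite, SatakeFrobCompatibleAt ι π.1 ρ v

/-- **LGC — local–global compatibility for irreducible pairs, proved ONCE** (the only statement
that mentions the reciprocity datum; `∃ Rec` lives here). -/
def PairCompatibility : Prop :=
  ∀ (K : Type) [Field K] [NumberField K], ∃ Rec : ReciprocityData K,
    ∀ (n : ℕ) (hcpt : isCompact_glFiniteIntegralLevel n K), 0 < n →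
      ∀ (π : CuspidalAutomorphicRepData n K hcpt), π.1.IsLAlgebraic →
        ∀ (ℓ : ℕ) [Fact ℓ.Prime] (ι : PadicAlgCl ℓ ≃+* ℂ) (ρ : FramedGaloisRep K (PadicAlgCl ℓ) n),
          ρ.toGaloisRep.IsIrreducible → IsGeometricPinned ρ →
            (∀ᶠ v : HeightOneSpectrum (𝓞 K) in cofinite, SatakeFrobCompatibleAt ι π.1 ρ v) →
              ∀ v : HeightOneSpectrum (𝓞 K), LocalGlobalCompatibleAt Rec ι π.1 ρ v

/-- **IsobaricRigidity (THE LEVER, Jacquet–Shalika 1981 II Thm 4.4 read at unramified places):**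
the Satake family of a CUSPIDAL `π` on `GL_n` is not, at almost all places, the union of the
Satake families of `k ≥ 2` cuspidal representations of smaller `GL_{m_i}`.  Proof line in tree
vocabulary: twist to unitary families; `L^S(s, π × π̃_{i₀})` (`i₀` of maximal real twist
exponent) is finite on `Re s ≥ 1` by JS (2.2) (`JacquetShalika1981_partialPairL_boundary_repData`,
`n ≠ m_{i₀}`) but factors as `∏_i L^S(s + s − s_i, π_i × π̃_{i₀})` with a pole from `i = i₀`
(JS (2.3), `JacquetShalika1981_partialPairL_pole_repData`) and non-vanishing other factors. -/
def IsobaricRigidity : Prop :=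
  ∀ (K : Type) [Field K] [NumberField K] (n : ℕ) (hcpt : isCompact_glFiniteIntegralLevel n K)
    (π : CuspidalAutomorphicRepData n K hcpt) (k : ℕ) (m : Fin k → ℕ)
    (hm : ∀ i, isCompact_glFiniteIntegralLevel (m i) K)
    (σ : ∀ i, CuspidalAutomorphicRepData (m i) K (hm i)),
    2 ≤ k → (∀ i, 0 < m i) →
      ¬ ∀ᶠ v : HeightOneSpectrum (𝓞 K) in cofinite, ∀ α : Multiset ℂ, π.1.HasSatakeParamAt v α →
        ∃ β : Fin k → Multiset ℂ, (∀ i, (σ i).1.HasSatakeParamAt v (β i)) ∧ α = ∑ i, β i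

/-- **GeometricConstituents (linear algebra + the pinned datum's sub-object stability):** a
geometric framed representation has a finite family of IRREDUCIBLE geometric framed
"constituents" whose Frobenius polynomials multiply to its own at every element, unramified
wherever it is, and it is irreducible as soon as there is exactly one constituent (a
representation whose semisimplification is irreducible is irreducible — landed in rank 3 as
`stub_not_isIrreducible_of_charpoly_eq`). -/
def GeometricConstituents : Prop :=
  ∀ (K : Type) [Field K] [NumberField K] (ℓ : ℕ) [Fact ℓ.Prime] (n : ℕ)
    (ρ : FramedGaloisRep K (PadicAlgCl ℓ) n), 0 < n → IsGeometricPinned ρ →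
      ∃ (k : ℕ) (m : Fin k → ℕ) (r : ∀ i, FramedGaloisRep K (PadicAlgCl ℓ) (m i)),
        (∀ i, 0 < m i ∧ (r i).toGaloisRep.IsIrreducible ∧ IsGeometricPinned (r i)) ∧
        (∀ g : Field.absoluteGaloisGroup K, ρ.charpoly g = ∏ i, (r i).charpoly g) ∧
        (∀ v : HeightOneSpectrum (𝓞 K), ρ.IsUnramifiedAt v → ∀ i, (r i).IsUnramifiedAt v) ∧
        (k = 1 → ρ.toGaloisRep.IsIrreducible)

/-- **First lemma of the line (the bootstrap, irreducibility half):** under (B) for ALL ranks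
over `K` (as the crux `E` provides, with one `Rec`), every geometric `ρ` attached a.e. to a
CUSPIDAL `π` is irreducible — "if Fontaine–Mazur–Langlands holds, reducibility of an attached
`ℓ`-adic representation shows `π` could not be cuspidal" (Calegari–Gee arXiv:1104.4827 §1 p. 3;
Ramakrishnan arXiv:math/0609460 §0 (0.2)–(0.3)).  To be proved in crux-plan from the two
stubs above + `arithFrobPolyOfSatake_sum` + `arithFrobPolyOfSatake_one_injective`. -/
theorem isIrreducible_of_weakAutomorphy_allRanks
    (hJS : IsobaricRigidity) (hC : GeometricConstituents) (hB : WeakAutomorphy)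
    (K : Type) [Field K] [NumberField K] (n : ℕ) (hcpt : isCompact_glFiniteIntegralLevel n K)
    (hn : 0 < n) (π : CuspidalAutomorphicRepData n K hcpt)
    (ℓ : ℕ) [Fact ℓ.Prime] (ι : PadicAlgCl ℓ ≃+* ℂ) (ρ : FramedGaloisRep K (PadicAlgCl ℓ) n)
    (hgeo : IsGeometricPinned ρ)
    (hρ : ∀ᶠ v : HeightOneSpectrum (𝓞 K) in cofinite, SatakeFrobCompatibleAt ι π.1 ρ v) :
    ρ.toGaloisRep.IsIrreducible := by
  obtain ⟨k, m, r, hr, hchar, -, hone⟩ := hC K ℓ n ρ hn hgeo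
  by_cases hk1 : k = 1
  · exact hone hk1
  -- `k = 0` is impossible: the characteristic polynomial of `ρ 1` has degree `n > 0`
  have hk0 : k ≠ 0 := by
    rintro rfl
    have h1 := hchar 1
    simp only [Finset.univ_eq_empty, Finset.prod_empty] at h1
    have hdeg : (FramedRep.charpoly ρ 1).natDegree = n := by
      simp [FramedRep.charpoly, Matrix.charpoly_natDegree_eq_dim]
    rw [h1, natDegree_one] at hdeg
    omega
  have hk2 : 2 ≤ k := by omega
  -- (B) in rank `m i` makes every constituent automorphic
  have hσ : ∀ i, ∃ σ : CuspidalAutomorphicRepData (m i) K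
      (isCompact_glFiniteIntegralLevel_holds (m i) K),
      σ.1.IsLAlgebraic ∧ ∀ᶠ v : HeightOneSpectrum (𝓞 K) in cofinite,
        SatakeFrobCompatibleAt ι σ.1 (r i) v :=
    fun i => hB K (m i) _ (hr i).1 ℓ ι (r i) (hr i).2.1 (hr i).2.2
  choose σ _hσL hσc using hσ
  refine (hJS K n hcpt π k m (fun i => isCompact_glFiniteIntegralLevel_holds (m i) K) σ hk2
    (fun i => (hr i).1) ?_).elim
  have hall : ∀ᶠ v : HeightOneSpectrum (𝓞 K) in cofinite,
      ∀ i, SatakeFrobCompatibleAt ι (σ i).1 (r i) v :=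
    Filter.eventually_all.mpr hσc
  filter_upwards [hρ, hall] with v hv hvi
  intro α hα
  obtain ⟨α₀, hα₀, -, hcp⟩ := hv
  obtain rfl : α = α₀ := AutomorphicRepData.hasSatakeParamAt_unique_holds π.1 hα hα₀
  choose β hβ _hurβ hcpβ using hvi
  refine ⟨β, hβ, ?_⟩
  -- the Frobenius polynomial of `ρ` is the product of those of the constituents
  have hprod : ρ.HasFrobCharpolyAt v (∏ i, arithFrobPolyOfSatake ι v.residueCard 1 (β i)) := by
    intro 𝔓 h𝔓 τ hτ
    rw [hchar τ]
    exact Finset.prod_congr rfl fun i _ => hcpβ i 𝔓 h𝔓 τ hτ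
  rw [← arithFrobPolyOfSatake_sum] at hprod
  have heq : arithFrobPolyOfSatake ι v.residueCard 1 α =
      arithFrobPolyOfSatake ι v.residueCard 1 (∑ i, β i) :=
    GaloisRep.HasFrobCharpolyAt.unique_holds
      ((FramedGaloisRep.hasFrobCharpolyAt_toGaloisRep_iff v _ ρ).mpr hcp)
      ((FramedGaloisRep.hasFrobCharpolyAt_toGaloisRep_iff v _ ρ).mpr hprod)
  exact arithFrobPolyOfSatake_one_injective ι _ heq

/-- **The decoupling (composition theorem of the skeleton this card proposes), PROVED modulo
the named stubs:** `E ⟸ JS-rigidity ∧ constituents ∧ W ∧ B_w ∧ LGC`.  No strong multiplicity one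
is needed: `PairCompatibility` is applied to the GIVEN `π`, and its `Rec` serves both conjuncts. -/
theorem reciprocityUpToIrreducibility_of
    (hJS : IsobaricRigidity) (hC : GeometricConstituents)
    (hW : WeakExistence) (hB : WeakAutomorphy) (hL : PairCompatibility) :
    ReciprocityUpToIrreducibility := by
  intro F _ _
  obtain ⟨Rec, hRec⟩ := hL F
  refine ⟨Rec, fun n hn hcpt => ⟨fun π hLalg ℓ _ ι => ?_, fun ℓ _ ι ρ hirr hgeo => ?_⟩⟩
  · obtain ⟨ρ, hgeo, hρ⟩ := hW F n hcpt hn π hLalg ℓ ι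
    have hirr : ρ.toGaloisRep.IsIrreducible :=
      isIrreducible_of_weakAutomorphy_allRanks hJS hC hB F n hcpt hn π ℓ ι ρ hgeo hρ
    exact ⟨ρ, hgeo, hρ, hRec n hcpt hn π hLalg ℓ ι ρ hirr hgeo hρ⟩
  · obtain ⟨π, hLalg, hρ⟩ := hB F n hcpt hn ℓ ι ρ hirr hgeo
    exact ⟨π, hLalg, hρ, hRec n hcpt hn π hLalg ℓ ι ρ hirr hgeo hρ⟩

/-- **By-product: the crux IS the summit.**  `E → Langlands` given the two rigidity stubs (the
prover's p78886 has `Langlands ↔ E ∧ I`; the bootstrap supplies `I` from `E`). -/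
theorem langlands_of_reciprocityUpToIrreducibility
    (hJS : IsobaricRigidity) (hC : GeometricConstituents) (hE : ReciprocityUpToIrreducibility) :
    _root_.Langlands := by
  -- (B) of the crux, read weakly, for every field and rank
  have hBw : WeakAutomorphy := by
    intro K _ _ n hcpt hn ℓ _ ι ρ hirr hgeo
    obtain ⟨Rec, hRec⟩ := hE K
    obtain ⟨-, hB⟩ := hRec n hn hcpt
    obtain ⟨π, hL, hcorr⟩ := hB ℓ ι ρ hirr hgeo
    exact ⟨π, hL, hcorr.1⟩
  refine langlands_iff_reciprocityUpToIrreducibility_and_irreducible.mpr ⟨hE, ?_⟩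
  intro n K _ _ hcpt hn π hL ℓ _ ι ρ hρ
  obtain ⟨Rec, hRec⟩ := hE K
  obtain ⟨hA, -⟩ := hRec n hn hcpt
  obtain ⟨ρ₀, hgeo₀, hcorr₀⟩ := hA π hL ℓ ι
  -- the bootstrap: the avatar the crux provides is irreducible
  have hirr₀ : ρ₀.toGaloisRep.IsIrreducible :=
    isIrreducible_of_weakAutomorphy_allRanks hJS hC hBw K n hcpt hn π ℓ ι ρ₀ hgeo₀ hcorr₀.1
  -- any other a.e.-compatible `ρ`: its continuous semisimplification is equivalent to `ρ₀`
  obtain ⟨r, hrss, hrcp, hrker⟩ := stub_continuousSemisimplification K ℓ n ρ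
  have hs₀ : ρ₀.toGaloisRep.IsSemisimple := by
    haveI := hirr₀
    change ComplementedLattice _
    infer_instance
  have hev : ∀ᶠ v : HeightOneSpectrum (𝓞 K) in cofinite,
      ρ₀.IsUnramifiedAt v ∧ r.IsUnramifiedAt v ∧
        ∃ P : Polynomial (PadicAlgCl ℓ), ρ₀.HasFrobCharpolyAt v P ∧ r.HasFrobCharpolyAt v P := by
    filter_upwards [hcorr₀.1, hρ] with v hv₀ hv
    obtain ⟨α₀, hα₀, hur₀, hcp₀⟩ := hv₀
    obtain ⟨α, hα, hur, hcp⟩ := hv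
    obtain rfl : α = α₀ := AutomorphicRepData.hasSatakeParamAt_unique_holds π.1 hα hα₀
    exact ⟨hur₀, fun 𝔓 h𝔓 σ hσ => hrker σ (hur 𝔓 h𝔓 σ hσ), _, hcp₀,
      fun 𝔓 h𝔓 σ hσ => (hrcp σ).trans (hcp 𝔓 h𝔓 σ hσ)⟩
  obtain ⟨e⟩ :=
    FramedGaloisRep.nonempty_equiv_of_hasFrobCharpolyAt_eventually chebotarev_artinRep_holds ρ₀ r
      hs₀ hrss hev
  have hrirr : r.toGaloisRep.IsIrreducible := by
    haveI := hirr₀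
    exact Literature.RepresentationTheory.Semisimple.Representation.isIrreducible_of_equiv e.toRepEquiv
  by_contra hirr
  exact stub_not_isIrreducible_of_charpoly_eq K ℓ n ρ r hrss hrcp hirr hrirr

/-! ## 2. One prime suffices (card `one-prime-companions`) -/

/-- **Companions (compatible-system rigidity, Frobenius-polynomial form):** a geometric `ℓ`-adic
representation has, for every other prime `ℓ'` and every pair of complex transports, a geometric
`ℓ'`-adic partner with the same complex Frobenius polynomials almost everywhere.  Known only via
potential automorphy (BLGGT arXiv:1010.2561 Thm 5.4.1: regular, odd, polarizable, TR/CM). -/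
def Companions : Prop :=
  ∀ (K : Type) [Field K] [NumberField K] (n : ℕ) (ℓ ℓ' : ℕ) [Fact ℓ.Prime] [Fact ℓ'.Prime]
    (ι : PadicAlgCl ℓ ≃+* ℂ) (ι' : PadicAlgCl ℓ' ≃+* ℂ) (ρ : FramedGaloisRep K (PadicAlgCl ℓ) n),
    IsGeometricPinned ρ →
      ∃ ρ' : FramedGaloisRep K (PadicAlgCl ℓ') n, IsGeometricPinned ρ' ∧
        ∀ᶠ v : HeightOneSpectrum (𝓞 K) in cofinite, ρ.IsUnramifiedAt v ∧ ρ'.IsUnramifiedAt v ∧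
          ∃ P : Polynomial ℂ, ρ.HasFrobCharpolyAt v (P.map (ι.symm : ℂ →+* PadicAlgCl ℓ)) ∧
            ρ'.HasFrobCharpolyAt v (P.map (ι'.symm : ℂ →+* PadicAlgCl ℓ'))

/-- **A_∃ — existence at ONE prime of our choosing** (per `π`). -/
def ExistenceAtOnePrime : Prop :=
  ∀ (K : Type) [Field K] [NumberField K] (n : ℕ) (hcpt : isCompact_glFiniteIntegralLevel n K),
    0 < n → ∀ π : CuspidalAutomorphicRepData n K hcpt, π.1.IsLAlgebraic →
      ∃ (ℓ : ℕ) (_ : Fact ℓ.Prime) (ι : PadicAlgCl ℓ ≃+* ℂ) (ρ : FramedGaloisRep K (PadicAlgCl ℓ) n),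
        IsGeometricPinned ρ ∧
          ∀ᶠ v : HeightOneSpectrum (𝓞 K) in cofinite, SatakeFrobCompatibleAt ι π.1 ρ v

/-- **B_∃ — automorphy of a companion at ONE prime of our choosing** (per `ρ`): the natural
output of every automorphy-lifting engine, run at a large / adequate / Fontaine–Laffaille prime of
the compatible system through `ρ` (irreducibility of the companion is Companions' business: Deligne's
conjecture includes it).  The level witness is the proved `isCompact_glFiniteIntegralLevel_holds`
(any two witnesses are definitionally equal). -/
def AutomorphyAtOnePrime : Prop :=
  ∀ (K : Type) [Field K] [NumberField K] (n : ℕ) (ℓ : ℕ) [Fact ℓ.Prime] (ι : PadicAlgCl ℓ ≃+* ℂ)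
    (ρ : FramedGaloisRep K (PadicAlgCl ℓ) n), 0 < n → ρ.toGaloisRep.IsIrreducible →
      IsGeometricPinned ρ →
      ∃ (ℓ₁ : ℕ) (_ : Fact ℓ₁.Prime) (ι₁ : PadicAlgCl ℓ₁ ≃+* ℂ) (r : FramedGaloisRep K (PadicAlgCl ℓ₁) n)
        (σ : CuspidalAutomorphicRepData n K (isCompact_glFiniteIntegralLevel_holds n K)),
        σ.1.IsLAlgebraic ∧
        (∀ᶠ v : HeightOneSpectrum (𝓞 K) in cofinite, SatakeFrobCompatibleAt ι₁ σ.1 r v) ∧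
        ∀ᶠ v : HeightOneSpectrum (𝓞 K) in cofinite, ρ.IsUnramifiedAt v ∧
          ∃ P : Polynomial ℂ, ρ.HasFrobCharpolyAt v (P.map (ι.symm : ℂ →+* PadicAlgCl ℓ)) ∧
            r.HasFrobCharpolyAt v (P.map (ι₁.symm : ℂ →+* PadicAlgCl ℓ₁))

/-- The complex Satake polynomial `∏_{a ∈ α} (X - a⁻¹)` whose `ι⁻¹`-transport is
`arithFrobPolyOfSatake ι q 1 α`. -/
def satakePolyC (α : Multiset ℂ) : Polynomial ℂ := (α.map fun a => X - C a⁻¹).prod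

theorem arithFrobPolyOfSatake_one_eq_map {ℓ : ℕ} [Fact ℓ.Prime] (ι : PadicAlgCl ℓ ≃+* ℂ)
    (q : ℕ) (α : Multiset ℂ) :
    arithFrobPolyOfSatake ι q 1 α = (satakePolyC α).map (ι.symm : ℂ →+* PadicAlgCl ℓ) := by
  rw [arithFrobPolyOfSatake_one, satakePolyC, Polynomial.map_multiset_prod, Multiset.map_map]
  congr 1
  refine Multiset.map_congr rfl fun a _ => ?_
  simp [Polynomial.map_sub, Polynomial.map_X, Polynomial.map_C]

/-- Transport of a Frobenius polynomial through two complex structures. -/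
theorem eq_satakePolyC_of_hasFrobCharpolyAt {K : Type} [Field K] [NumberField K] {ℓ : ℕ}
    [Fact ℓ.Prime] (ι : PadicAlgCl ℓ ≃+* ℂ) {n : ℕ} {ρ : FramedGaloisRep K (PadicAlgCl ℓ) n}
    {v : HeightOneSpectrum (𝓞 K)} {α : Multiset ℂ} {P : Polynomial ℂ}
    (hα : ρ.HasFrobCharpolyAt v (arithFrobPolyOfSatake ι v.residueCard 1 α))
    (hP : ρ.HasFrobCharpolyAt v (P.map (ι.symm : ℂ →+* PadicAlgCl ℓ))) : P = satakePolyC α := by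
  have h1 : P.map (ι.symm : ℂ →+* PadicAlgCl ℓ) = arithFrobPolyOfSatake ι v.residueCard 1 α :=
    GaloisRep.HasFrobCharpolyAt.unique_holds
      ((FramedGaloisRep.hasFrobCharpolyAt_toGaloisRep_iff v _ ρ).mpr hP)
      ((FramedGaloisRep.hasFrobCharpolyAt_toGaloisRep_iff v _ ρ).mpr hα)
  rw [arithFrobPolyOfSatake_one_eq_map] at h1
  exact Polynomial.map_injective _ ι.symm.injective h1

/-- **First lemma of card 2 (ℓ-transport), PROVED:** one prime per object + companions ⇒ all
primes, for both weak directions. -/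
theorem weak_of_onePrime (hComp : Companions) (hA : ExistenceAtOnePrime)
    (hB : AutomorphyAtOnePrime) : WeakExistence ∧ WeakAutomorphy := by
  constructor
  · intro K _ _ n hcpt hn π hL ℓ _ ι
    obtain ⟨ℓ₀, inst₀, ι₀, ρ₀, hgeo₀, hρ₀⟩ := hA K n hcpt hn π hL
    obtain ⟨ρ', hgeo', hev⟩ := hComp K n ℓ₀ ℓ ι₀ ι ρ₀ hgeo₀
    refine ⟨ρ', hgeo', ?_⟩
    filter_upwards [hρ₀, hev] with v hv hv'
    obtain ⟨α, hα, -, hcp₀⟩ := hv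
    obtain ⟨-, hur', P, hP₀, hP'⟩ := hv'
    obtain rfl : P = satakePolyC α := eq_satakePolyC_of_hasFrobCharpolyAt ι₀ hcp₀ hP₀
    refine ⟨α, hα, hur', ?_⟩
    rwa [arithFrobPolyOfSatake_one_eq_map]
  · intro K _ _ n hcpt hn ℓ _ ι ρ hirr hgeo
    obtain ⟨ℓ₁, inst₁, ι₁, r, σ, hL, hσr, hev⟩ := hB K n ℓ ι ρ hn hirr hgeo
    refine ⟨σ, hL, ?_⟩
    filter_upwards [hσr, hev] with v hv hv'
    obtain ⟨α, hα, -, hcpr⟩ := hv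
    obtain ⟨hurρ, P, hPρ, hPr⟩ := hv'
    obtain rfl : P = satakePolyC α := eq_satakePolyC_of_hasFrobCharpolyAt ι₁ hcpr hPr
    refine ⟨α, hα, hurρ, ?_⟩
    rwa [arithFrobPolyOfSatake_one_eq_map]

end Summit.Langlands.Langlands.Cruxes.ReciprocityUpToIrreducibility.Sketch

end
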